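import Literature.Combinatorics.LorentzianPolynomials.PottsHessianSignature
import Literature.Combinatorics.LorentzianPolynomials.IndependencePolynomialLorentzian
import Literature.Topology.FourManifolds.LatticeFormsOrthoSumSignature
import Mathlib.Combinatorics.Matroid.Rank.ENat
import Mathlib.Combinatorics.Matroid.Constructions
import HarnessLib

/-!
# The homogeneous multivariate Tutte polynomial `Z_{q,M}` is Lorentzian for `0 < q ≤ 1` (Brändén–Huh 2020, Thm. 4.10)

Layer `Literature/Combinatorics/LorentzianPolynomials`, namespace `Literature.Combinatorics.LorentzianPolynomials`;
lane `lit-hodgefound` (Track 2 foundations library), seat p16, generation 28 (row g28-#8 (b)). For a matroid `M` on a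
finite type `σ` (`n = |σ|`, rank function `rk_M`, Mathlib's `Matroid.eRk` made natural) and a real parameter `q`, the
polynomial `Z_{q,M} = Σ_{A ⊆ σ} q^{-rk_M(A)} w^A w_0^{n-|A|} ∈ ℝ[w_0, (w_i)_{i∈σ}]` (`MvPolynomial (Option σ) ℝ`, `w_0 = none`)
— for the cycle matroid of a graph and `w_0 = 1` the partition function of the `q`-state Potts model — is Lorentzian in
the sense of the tree's Def. 2.6 (`lorentzian (Option σ) n`) whenever `0 < q ≤ 1`. The proof is the printed one, organised
as for `f_M` (`IndependencePolynomialLorentzian.lean`, the `q → 0` end): by `mem_lorentzian_iff_forall_sigPos_normCoeff`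
one needs (i) the M-convexity of the support `{(n-|A|) e_0 + e_A}` (Lemma 4.11; here `= indepExp` of the free matroid,
`isMConvex_indepExp`), and (ii) for every `α ∈ Δ^{n-2}_{n+1}` at most one positive eigenvalue of the matrix
`((α + e_i + e_j)! coeff Z_{q,M})_{i,j}`: this matrix vanishes unless `α = (m-2) e_0 + e_S` with `S ⊆ σ`, and then — since
`∂^S Z_{q,M} = q^{-rk S} Z_{q,M/S}` ("`∂_i Z_{q,M} = q^{-rk(i)} Z_{q,M/i}`") — it is `(m-2)! q^{-rk S} · D H D`, where `H` is
the matrix of `PottsHessianSignature.lean` for the ground set `T = σ ∖ S` of `M/S`, its parallel classes (non-loops) and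
singleton classes (loops), and `D = diag(1, (q^{-[k non-loop of M/S]})_k)` is Brändén–Huh's change of variables
`w_i ↦ q w_i` on the non-loops; `sigPos (D H D) ≤ sigPos H ≤ 1` (`sigPos_pottsMatrix_le_one`, Lemma 4.12). The ranks
`rk(S + k)`, `rk(S + k + l)` are computed through a basis `I` of `S` (`rk(S ∪ Y) = rk(I ∪ Y)`), the non-loops of `M/S`
outside `S` being `nonloopsOver M I` and the parallel classes those of `ParallelOver M I` (`ParallelOver.lean`).

## Source (verbatim) — P. Brändén, J. Huh, *Lorentzian polynomials* [BrandenHuh2019] (held `paper:arxiv-1902.03719`)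

§4.3: "Let `M` be a matroid on `[n]`, and let `rk_M` be the rank function of `M`. For a nonnegative integer `k` and a
positive real parameter `q`, consider the degree `k` homogeneous polynomial in `n` variables
`Z^k_{q,M}(w) = Σ_{A ∈ [n choose k]} q^{-rk_M(A)} w^A`. We define the homogeneous multivariate Tutte polynomial of `M` by
`Z_{q,M}(w_0, w_1, …, w_n) = Σ_{k=0}^n Z^k_{q,M}(w) w_0^{n-k}`, which is a homogeneous polynomial of degree `n` in `n + 1`
variables. When `M` is the cycle matroid of a graph `G`, the polynomial obtained from `Z_{q,M}` by setting `w_0 = 1` is the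
partition function of the `q`-state Potts model associated to `G` [Sokal]. […] **Theorem 4.10.** For any matroid `M` and
`0 < q ≤ 1`, the polynomial `Z_{q,M}` is Lorentzian. […] **Lemma 4.11.** The support of `Z_{q,M}` is M-convex for all
`0 < q ≤ 1`. […] *Proof of Theorem 4.10.* Let `α` be an element of `Δ^{n-2}_{n+1}`. By Theorem 2.25 and Lemma 4.11, the
proof reduces to the statement that the quadratic form `∂^α Z_{q,M}` is stable. […] When `i ≠ 0`, we have
`∂_i Z_{q,M} = q^{-rk_M(i)} Z_{q,M/i}`, where `M/i` is the contraction of `M` by `i` [Oxley]. Thus, it is enough to prove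
that the following quadratic form is stable: `(n!/2) w_0^2 + (n-1)! Z^1_{q,M}(w) w_0 + (n-2)! Z^2_{q,M}(w)`. […] We prove
the inequality after making the change of variables `w_i ↦ w_i` if `i` is a loop in `M`, `w_i ↦ q w_i` if `i` is not a
loop in `M`. […] The conclusion now follows from Lemma 4.12."

## What is here (`M : Matroid σ`, `σ` a finite type, `n = Fintype.card σ`)

* §1 `matroidRank M A = (M.eRk A).toNat ∈ ℕ` and its calculus on a finite type (`cast_matroidRank`, monotonicity, unit
  increase, `rk (S ∪ Y) = rk (I ∪ Y)` for a basis `I` of `S`, `rk (I + e)`, `rk (I + l + k) = rk (I + k)` for a loop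
  `l` of `M/I`);
* §2 **`pottsPoly q M = Z_{q,M}`**, its coefficients (`coeff_pottsPoly`), support (`support_pottsPoly` `= indepExp (freeOn univ)`,
  **Lemma 4.11** `isMConvex_support_pottsPoly`), homogeneity, normalised coefficients;
* §3 the class map `pottsClassMap M I` (parallel classes of the non-loops of `M/I`, singletons otherwise) and the
  rescaling `pottsScale q M I` (`d`), with `q^{-rk(I+k)} = q^{-|I|} d_k` and
  `q^{-rk(I+k+l)} = q^{-|I|} d_k d_l c_{kl}` (`inv_pow_matroidRank_insert_insert`);
* §4 **`normCoeff_pottsPoly_add_eq`**: the Hessian matrix of `∂^α Z_{q,M}` is `(m-2)! q^{-rk S} · D H D`;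
* §5 `sigPos_toBilin'_diag_mul_le` (diagonal congruence) and **`pottsPoly_mem_lorentzian`** (Theorem 4.10).

Four definitions with bodies (`matroidRank`, `pottsPoly`, `pottsClassMap`, `pottsScale`), theorems otherwise; no `sorry`,
no named fact (net debt 0).

## References

* [BrandenHuh2019] P. Brändén, J. Huh, *Lorentzian polynomials*, Ann. of Math. (2) 192 (2020) 821–891, arXiv:1902.03719 —
  §4.3 Thm. 4.10, Lemmas 4.11, 4.12 and the proof of Thm. 4.10; §2.4 Thm. 2.25 (the Hessian criterion).
* J. Oxley, *Matroid theory*, 2nd ed., OUP 2011, §3.1–3.3 (contraction, loops and parallel classes of `M/S`, rank of a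
  contraction) — as cited by [BrandenHuh2019]; here through Mathlib's `Matroid.eRk` / closure and the tree's `ParallelOver`.
-/
noncomputable section

open MvPolynomial Finset Matrix Nat
open Literature.LinearAlgebra.QuadraticForm

namespace Literature.Combinatorics.LorentzianPolynomials

variable {σ : Type*}

/-! ## §1 The rank function of a matroid on a finite type, in `ℕ` -/

section Rank

/-- **The rank `rk_M(A) ∈ ℕ`** of a set in a matroid on a finite type: Mathlib's `ℕ∞`-valued `Matroid.eRk` made natural
(all ranks are finite here). [cite: BrandenHuh2019, §4.3 (before Thm. 4.10: "let `rk_M` be the rank function of `M`")] -/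
def matroidRank (M : Matroid σ) (A : Set σ) : ℕ := (M.eRk A).toNat

/-- The rank of an independent set is its size. [cite: BrandenHuh2019, §4.3] -/
theorem matroidRank_eq_ncard_of_indep {M : Matroid σ} {I : Set σ} (hI : M.Indep I) : matroidRank M I = I.ncard := by
  rw [matroidRank, hI.eRk_eq_encard, Set.ncard_def]

variable [Fintype σ]

/-- `rk_M(A)` is finite: `↑(rk_M A) = eRk A`. [cite: BrandenHuh2019, §4.3] -/
theorem cast_matroidRank (M : Matroid σ) (A : Set σ) : (matroidRank M A : ℕ∞) = M.eRk A :=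
  ENat.coe_toNat ((M.eRk_le_encard A).trans_lt (Set.toFinite A).encard_lt_top).ne

/-- Monotonicity of the rank. [cite: BrandenHuh2019, §4.3] -/
theorem matroidRank_mono (M : Matroid σ) {A B : Set σ} (h : A ⊆ B) : matroidRank M A ≤ matroidRank M B := by
  have := M.eRk_mono h
  rw [← cast_matroidRank, ← cast_matroidRank] at this
  exact_mod_cast this

/-- Unit increase: `rk (A + e) ≤ rk A + 1`. [cite: BrandenHuh2019, §4.3] -/
theorem matroidRank_insert_le (M : Matroid σ) (e : σ) (A : Set σ) :
    matroidRank M (insert e A) ≤ matroidRank M A + 1 := by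
  have := M.eRk_insert_le_add_one e A
  rw [← cast_matroidRank, ← cast_matroidRank] at this
  exact_mod_cast this

/-- A basis `I` of `S` computes all the ranks `rk (S ∪ Y) = rk (I ∪ Y)`. [cite: BrandenHuh2019, §4.3] -/
theorem matroidRank_union_eq_of_isBasis' {M : Matroid σ} {I S : Set σ} (hI : M.IsBasis' I S) (Y : Set σ) :
    matroidRank M (S ∪ Y) = matroidRank M (I ∪ Y) := by
  have := hI.eRk_eq_eRk_union Y
  rw [← cast_matroidRank, ← cast_matroidRank] at this
  exact_mod_cast this.symm

/-- In particular `rk S = rk I = |I|`. [cite: BrandenHuh2019, §4.3] -/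
theorem matroidRank_eq_ncard_of_isBasis' {M : Matroid σ} {I S : Set σ} (hI : M.IsBasis' I S) :
    matroidRank M S = I.ncard := by
  have := hI.eRk_eq_eRk
  rw [← cast_matroidRank, ← cast_matroidRank] at this
  rw [← matroidRank_eq_ncard_of_indep hI.indep]
  exact_mod_cast this.symm

/-- `rk (I + e) = |I| + 1` if `I + e` is independent (`e ∉ I`). [cite: BrandenHuh2019, §4.3] -/
theorem matroidRank_insert_of_indep {M : Matroid σ} {I : Set σ} {e : σ} (he : e ∉ I) (h : M.Indep (insert e I)) :
    matroidRank M (insert e I) = I.ncard + 1 := by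
  rw [matroidRank_eq_ncard_of_indep h, Set.ncard_insert_of_notMem he (Set.toFinite I)]

/-- `rk (I + e) = |I|` if `I` is independent and `I + e` is not. [cite: BrandenHuh2019, §4.3] -/
theorem matroidRank_insert_of_not_indep {M : Matroid σ} {I : Set σ} (hI : M.Indep I) {e : σ}
    (h : ¬ M.Indep (insert e I)) : matroidRank M (insert e I) = I.ncard := by
  have he : e ∉ I := fun he ↦ h (by rwa [Set.insert_eq_of_mem he])
  refine le_antisymm ?_ ?_
  · -- `rk (I+e) ≤ |I| + 1` and `≠ |I| + 1` (else `I + e` independent)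
    have h1 : matroidRank M (insert e I) ≤ I.ncard + 1 :=
      (matroidRank_insert_le M e I).trans (by rw [matroidRank_eq_ncard_of_indep hI])
    have h2 : matroidRank M (insert e I) ≠ I.ncard + 1 := fun heq ↦ h (by
      rw [Matroid.indep_iff_eRk_eq_encard_of_finite (Set.toFinite _), ← cast_matroidRank, heq,
        ← Set.ncard_insert_of_notMem he (Set.toFinite I), (Set.toFinite _).cast_ncard_eq])
    omega
  · rw [← matroidRank_eq_ncard_of_indep hI]
    exact matroidRank_mono M (Set.subset_insert _ _)

/-- If `I` is independent and `I + l` is not, then `l` does not change ranks over `I`: `rk (I + l + k) = rk (I + k)`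
(`l` is a loop of `M/I`). [cite: BrandenHuh2019, §4.3 proof of Thm. 4.10 ("`L ⊆ [n]` for the set of loops")] -/
theorem matroidRank_insert_insert_of_not_indep {M : Matroid σ} {I : Set σ} (hI : M.Indep I) {l : σ}
    (hl : ¬ M.Indep (insert l I)) (k : σ) : matroidRank M (insert k (insert l I)) = matroidRank M (insert k I) := by
  refine le_antisymm ?_ (matroidRank_mono M (Set.insert_subset_insert (Set.subset_insert _ _)))
  by_cases hlE : l ∈ M.E
  · -- `l ∈ closure I`, so `I + l + k ⊆ closure I ∪ {k}`, of rank `rk (I + k)`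
    have hlI : l ∉ I := fun h ↦ hl (by rwa [Set.insert_eq_of_mem h])
    have hcl : l ∈ M.closure I :=
      (hI.mem_closure_iff_of_notMem hlI).2 ⟨hl, Set.insert_subset hlE hI.subset_ground⟩
    have hsub : insert k (insert l I) ⊆ M.closure I ∪ {k} := by
      intro x hx
      rcases Set.mem_insert_iff.1 hx with rfl | hx
      · exact Set.mem_union_right _ (Set.mem_singleton _)
      rcases Set.mem_insert_iff.1 hx with rfl | hx
      · exact Set.mem_union_left _ hcl
      · exact Set.mem_union_left _ (M.subset_closure I hI.subset_ground hx)
    have h := M.eRk_mono hsub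
    rw [M.eRk_union_closure_left_eq I {k}, Set.union_singleton, ← cast_matroidRank, ← cast_matroidRank] at h
    exact_mod_cast h
  · rw [Set.insert_comm, matroidRank, M.eRk_insert_of_notMem_ground _ hlE, ← matroidRank]

end Rank

/-! ## §2 The polynomial `Z_{q,M}` -/

section Potts

variable [Fintype σ]

/-- **The homogeneous multivariate Tutte polynomial** `Z_{q,M}(w_0, w_1, …, w_n) = Σ_{A ⊆ [n]} q^{-rk_M(A)} w^A w_0^{n-|A|}`
of a matroid `M` on a finite set of size `n` (a homogeneous polynomial of degree `n` in `n + 1` variables; for the cycle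
matroid of a graph, `w_0 = 1` gives the partition function of the `q`-state Potts model), in `MvPolynomial (Option σ) ℝ`
with `w_0` the variable `none`. [cite: BrandenHuh2019, §4.3 (definition of `Z^k_{q,M}` and `Z_{q,M}`, before Thm. 4.10)] -/
def pottsPoly (q : ℝ) (M : Matroid σ) : MvPolynomial (Option σ) ℝ :=
  ∑ A : Finset σ, monomial (homIndSet (A : Set σ)) (q⁻¹ ^ matroidRank M A)

/-- Unfolding `Z_{q,M}`. [cite: BrandenHuh2019, §4.3] -/
theorem pottsPoly_def (q : ℝ) (M : Matroid σ) :
    pottsPoly q M = ∑ A : Finset σ, monomial (homIndSet (A : Set σ)) (q⁻¹ ^ matroidRank M A) := rfl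

variable [DecidableEq σ]

/-- The coefficient of `w^A w_0^{n-|A|}` in `Z_{q,M}` is `q^{-rk_M(A)}`. [cite: BrandenHuh2019, §4.3] -/
theorem coeff_pottsPoly_homIndSet (q : ℝ) (M : Matroid σ) (A : Finset σ) :
    coeff (homIndSet (A : Set σ)) (pottsPoly q M) = q⁻¹ ^ matroidRank M A := by
  rw [pottsPoly, coeff_sum, Finset.sum_eq_single A]
  · rw [coeff_monomial, if_pos rfl]
  · intro B _ hBA
    rw [coeff_monomial, if_neg]
    exact fun h ↦ hBA (Finset.coe_injective (homIndSet_injective h))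
  · exact fun h ↦ (h (Finset.mem_univ A)).elim

omit [DecidableEq σ] in
/-- The exponents of `Z_{q,M}` are the `(n - |A|) e_0 + e_A`, `A ⊆ [n]` — the exponents `indepExp` of the free matroid.
[cite: BrandenHuh2019, §4.3 proof of Lemma 4.11 ("`supp(Z^♮_{q,M}) = {0,1}^n`")] -/
theorem mem_indepExp_freeOn_iff {γ : Option σ →₀ ℕ} :
    γ ∈ indepExp (Matroid.freeOn (Set.univ : Set σ)) ↔ ∃ A : Finset σ, homIndSet (A : Set σ) = γ := by
  rw [mem_indepExp]
  constructor
  · rintro ⟨I, -, rfl⟩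
    exact ⟨(Set.toFinite I).toFinset, by rw [Set.Finite.coe_toFinset]⟩
  · rintro ⟨A, rfl⟩
    exact ⟨A, Matroid.freeOn_indep_iff.2 (Set.subset_univ _), rfl⟩

/-- **The coefficients of `Z_{q,M}`**: `coeff_γ Z_{q,M} = q^{-rk_M(supp γ)}` if `γ = (n-|A|) e_0 + e_A` for some `A`
(namely `A = sigmaSupport γ`), and `0` otherwise. [cite: BrandenHuh2019, §4.3] -/
theorem coeff_pottsPoly (q : ℝ) (M : Matroid σ) (γ : Option σ →₀ ℕ) :
    coeff γ (pottsPoly q M) =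
      if γ ∈ indepExp (Matroid.freeOn (Set.univ : Set σ)) then q⁻¹ ^ matroidRank M (sigmaSupport γ) else 0 := by
  split_ifs with h
  · obtain ⟨A, rfl⟩ := mem_indepExp_freeOn_iff.1 h
    rw [coeff_pottsPoly_homIndSet, sigmaSupport_homIndSet]
  · rw [pottsPoly, coeff_sum]
    refine Finset.sum_eq_zero fun A _ ↦ ?_
    rw [coeff_monomial, if_neg]
    exact fun hA ↦ h (mem_indepExp_freeOn_iff.2 ⟨A, hA⟩)

/-- The coefficients of `Z_{q,M}` are nonnegative for `q ≥ 0`. [cite: BrandenHuh2019, §4.3] -/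
theorem coeff_pottsPoly_nonneg {q : ℝ} (hq : 0 ≤ q) (M : Matroid σ) (γ : Option σ →₀ ℕ) :
    0 ≤ coeff γ (pottsPoly q M) := by
  rw [coeff_pottsPoly]
  split_ifs
  · exact pow_nonneg (inv_nonneg.2 hq) _
  · exact le_rfl

/-- **The support of `Z_{q,M}`** (`q > 0`) is `{(n-|A|) e_0 + e_A : A ⊆ [n]}`, the exponent set of the free matroid.
[cite: BrandenHuh2019, §4.3 proof of Lemma 4.11] -/
theorem support_pottsPoly {q : ℝ} (hq : 0 < q) (M : Matroid σ) :
    {γ : Option σ →₀ ℕ | coeff γ (pottsPoly q M) ≠ 0} = ↑(indepExp (Matroid.freeOn (Set.univ : Set σ))) := by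
  ext γ
  rw [Set.mem_setOf_eq, Finset.mem_coe, coeff_pottsPoly]
  split_ifs with h
  · exact iff_of_true (pow_ne_zero _ (inv_ne_zero hq.ne')) h
  · exact iff_of_false (fun h' ↦ h' rfl) h

/-- **Lemma 4.11: the support of `Z_{q,M}` is M-convex** (`q > 0`). [cite: BrandenHuh2019, §4.3 Lemma 4.11] -/
theorem isMConvex_support_pottsPoly {q : ℝ} (hq : 0 < q) (M : Matroid σ) :
    IsMConvex {γ : Option σ →₀ ℕ | coeff γ (pottsPoly q M) ≠ 0} := by
  rw [support_pottsPoly hq]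
  exact isMConvex_indepExp _

omit [DecidableEq σ] in
/-- `Z_{q,M}` is homogeneous of degree `n`. [cite: BrandenHuh2019, §4.3 ("a homogeneous polynomial of degree `n` in `n+1`
variables")] -/
theorem isHomogeneous_pottsPoly (q : ℝ) (M : Matroid σ) : (pottsPoly q M).IsHomogeneous (Fintype.card σ) := by
  rw [pottsPoly]
  exact IsHomogeneous.sum _ _ _ fun A _ ↦ isHomogeneous_monomial _ (degree_homIndSet _)

/-- **The normalised coefficients of `Z_{q,M}`**: `γ! · coeff_γ Z_{q,M} = [γ = (n-|A|) e_0 + e_A] · (γ_0)! · q^{-rk_M(A)}`.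
[cite: BrandenHuh2019, §2.2 (p. 11, normalised coefficients); §4.3 proof of Thm. 4.10] -/
theorem normCoeff_pottsPoly (q : ℝ) (M : Matroid σ) (γ : Option σ →₀ ℕ) :
    normCoeff γ (pottsPoly q M) =
      if γ ∈ indepExp (Matroid.freeOn (Set.univ : Set σ)) then
        ((γ none)! : ℝ) * q⁻¹ ^ matroidRank M (sigmaSupport γ) else 0 := by
  rw [normCoeff, coeff_pottsPoly]
  split_ifs with h
  · obtain ⟨A, rfl⟩ := mem_indepExp_freeOn_iff.1 h
    rw [factorialProd_homIndSet, homIndSet_none]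
  · rw [mul_zero]

/-- The degenerate cases `n ≤ 1`: `Z_{q,M}` is Lorentzian outright for `q ≥ 0` (degree `≤ 1`).
[cite: BrandenHuh2019, §2.2 Def. 2.6 (`L^0_n`, `L^1_n`); §4.3 proof of Thm. 4.10 ("The assertion is clear when `n = 1`")] -/
theorem pottsPoly_mem_lorentzian_of_card_le_one {q : ℝ} (hq : 0 ≤ q) (M : Matroid σ) (h : Fintype.card σ ≤ 1) :
    pottsPoly q M ∈ lorentzian (Option σ) (Fintype.card σ) := by
  rcases Nat.le_one_iff_eq_zero_or_eq_one.1 h with h0 | h1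
  · rw [h0]
    exact mem_lorentzian_zero.2 ⟨h0 ▸ isHomogeneous_pottsPoly q M, coeff_pottsPoly_nonneg hq M⟩
  · rw [h1]
    exact mem_lorentzian_one.2 ⟨h1 ▸ isHomogeneous_pottsPoly q M, coeff_pottsPoly_nonneg hq M⟩

end Potts

/-! ## §3 Loops and parallel classes of `M/S` through a basis `I` of `S`; Brändén–Huh's rescaling -/

section Contraction

variable [Fintype σ]

/-- **The class map of `M/I`** used for `Z_{q,M}`: a non-loop `k` of `M/I` (`k ∉ I`, `I + k` independent) goes to its
parallel class (`parallelClassMap`), every other element to itself (loops of `M/I` are pairwise "non-parallel": their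
mutual coefficients in `Z^2_{q,M/I}` are not rescaled). [cite: BrandenHuh2019, §4.3 proof of Thm. 4.10 ("Write `L ⊆ [n]`
for the set of loops and `P_1, …, P_ℓ ⊆ [n] ∖ L` for the parallel classes")] -/
def pottsClassMap (M : Matroid σ) (I : Set σ) (k : σ) : Option (Quotient (parallelOverSetoid M I)) ⊕ σ :=
  open Classical in if k ∈ nonloopsOver M I then Sum.inl (parallelClassMap M I k) else Sum.inr k

/-- Two distinct elements have the same class iff both are non-loops of `M/I` and they are parallel in `M/I`
(`I + k + l` dependent). [cite: BrandenHuh2019, §4.3 proof of Thm. 4.10] -/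
theorem pottsClassMap_eq_iff {M : Matroid σ} {I : Set σ} {k l : σ} (hkl : k ≠ l) :
    pottsClassMap M I k = pottsClassMap M I l ↔
      k ∈ nonloopsOver M I ∧ l ∈ nonloopsOver M I ∧ ¬ M.Indep (insert k (insert l I)) := by
  unfold pottsClassMap
  by_cases hk : k ∈ nonloopsOver M I
  · by_cases hl : l ∈ nonloopsOver M I
    · rw [if_pos hk, if_pos hl, Sum.inl.injEq, parallelClassMap_eq_iff hk hl]
      constructor
      · intro h
        exact ⟨hk, hl, fun hi ↦ (not_parallelOver_iff_indep hk hl hkl).2 hi h⟩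
      · rintro ⟨-, -, h⟩
        by_contra hp
        exact h ((not_parallelOver_iff_indep hk hl hkl).1 hp)
    · rw [if_pos hk, if_neg hl]
      exact iff_of_false Sum.inl_ne_inr fun h ↦ hl h.2.1
  · by_cases hl : l ∈ nonloopsOver M I
    · rw [if_neg hk, if_pos hl]
      exact iff_of_false Sum.inr_ne_inl fun h ↦ hk h.1
    · rw [if_neg hk, if_neg hl, Sum.inr.injEq]
      exact iff_of_false hkl fun h ↦ hk h.1

/-- **Brändén–Huh's rescaling** `w_i ↦ q w_i` of the non-loops of `M/I`, as the diagonal `d_0 = 1`, `d_k = q⁻¹` for `k` a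
non-loop of `M/I` and `d_k = 1` otherwise (the Hessian of `∂^α Z_{q,M}` is `D H D` for the rescaled Hessian `H`).
[cite: BrandenHuh2019, §4.3 proof of Thm. 4.10 ("We prove the inequality after making the change of variables
`w_i ↦ q w_i` if `i` is not a loop")] -/
def pottsScale (q : ℝ) (M : Matroid σ) (I : Set σ) : Option σ → ℝ :=
  open Classical in fun o ↦ o.elim 1 fun k ↦ if k ∈ nonloopsOver M I then q⁻¹ else 1

omit [Fintype σ] in
/-- `d_0 = 1`. [cite: BrandenHuh2019, §4.3 proof of Thm. 4.10] -/
theorem pottsScale_none (q : ℝ) (M : Matroid σ) (I : Set σ) : pottsScale q M I none = 1 := rfl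

omit [Fintype σ] in
/-- `d_k = q⁻¹` for a non-loop `k` of `M/I`. [cite: BrandenHuh2019, §4.3 proof of Thm. 4.10] -/
theorem pottsScale_some_of_mem (q : ℝ) {M : Matroid σ} {I : Set σ} {k : σ} (hk : k ∈ nonloopsOver M I) :
    pottsScale q M I (some k) = q⁻¹ := by
  simp [pottsScale, hk]

omit [Fintype σ] in
/-- `d_k = 1` for a loop `k` of `M/I` (or `k ∈ I`). [cite: BrandenHuh2019, §4.3 proof of Thm. 4.10] -/
theorem pottsScale_some_of_not_mem (q : ℝ) {M : Matroid σ} {I : Set σ} {k : σ} (hk : k ∉ nonloopsOver M I) :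
    pottsScale q M I (some k) = 1 := by
  simp [pottsScale, hk]

/-- `rk (I + k) = |I| + 1` for a non-loop `k` of `M/I`. [cite: BrandenHuh2019, §4.3 proof of Thm. 4.10
("`∂_i Z_{q,M} = q^{-rk_M(i)} Z_{q,M/i}`")] -/
theorem matroidRank_insert_of_mem_nonloopsOver {M : Matroid σ} {I : Set σ} {k : σ} (hk : k ∈ nonloopsOver M I) :
    matroidRank M (insert k I) = I.ncard + 1 :=
  matroidRank_insert_of_indep hk.1 hk.2

/-- `rk (I + k) = |I|` for `k ∉ I` a loop of `M/I` (`I` independent). [cite: BrandenHuh2019, §4.3 proof of Thm. 4.10] -/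
theorem matroidRank_insert_of_not_mem_nonloopsOver {M : Matroid σ} {I : Set σ} (hI : M.Indep I) {k : σ} (hkI : k ∉ I)
    (hk : k ∉ nonloopsOver M I) : matroidRank M (insert k I) = I.ncard :=
  matroidRank_insert_of_not_indep hI fun h ↦ hk ⟨hkI, h⟩

/-- The power `q^{-rk(I + k)} = q^{-|I|} · d_k` (`k ∉ I`, `I` independent). [cite: BrandenHuh2019, §4.3 proof of Thm. 4.10] -/
theorem inv_pow_matroidRank_insert {M : Matroid σ} {I : Set σ} (hI : M.Indep I) {k : σ} (hkI : k ∉ I) (q : ℝ) :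
    (q⁻¹) ^ matroidRank M (insert k I) = (q⁻¹) ^ I.ncard * pottsScale q M I (some k) := by
  by_cases hk : k ∈ nonloopsOver M I
  · rw [matroidRank_insert_of_mem_nonloopsOver hk, pottsScale_some_of_mem q hk, pow_succ]
  · rw [matroidRank_insert_of_not_mem_nonloopsOver hI hkI hk, pottsScale_some_of_not_mem q hk, mul_one]

/-- **The power `q^{-rk(I + k + l)}`** for distinct `k, l ∉ I` (`I` independent): `q^{-|I|} · d_k · d_l · c_{kl}` with
`c_{kl} = q` if `k, l` are parallel non-loops of `M/I` and `1` otherwise — the four cases loop/loop, loop/non-loop,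
parallel, independent of ranks `|I|`, `|I|+1`, `|I|+1`, `|I|+2`. [cite: BrandenHuh2019, §4.3 proof of Thm. 4.10
("`Z^2_{q,M}(w) = e^2_{[n]}(w) - (1-q)(e^2_{P_1}(w) + ⋯ + e^2_{P_ℓ}(w))`" after the change of variables)] -/
theorem inv_pow_matroidRank_insert_insert {M : Matroid σ} {I : Set σ} (hI : M.Indep I) {k l : σ} (hkl : k ≠ l)
    (hkI : k ∉ I) (hlI : l ∉ I) {q : ℝ} (hq : q ≠ 0) [DecidableEq (Option (Quotient (parallelOverSetoid M I)) ⊕ σ)] :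
    (q⁻¹) ^ matroidRank M (insert k (insert l I)) = (q⁻¹) ^ I.ncard *
      (pottsScale q M I (some k) * pottsScale q M I (some l) *
        if pottsClassMap M I k = pottsClassMap M I l then q else 1) := by
  by_cases hl : l ∈ nonloopsOver M I
  · by_cases hk : k ∈ nonloopsOver M I
    · rw [pottsScale_some_of_mem q hk, pottsScale_some_of_mem q hl]
      by_cases hind : M.Indep (insert k (insert l I))
      · -- independent pair: rank `|I| + 2`
        have hne : pottsClassMap M I k ≠ pottsClassMap M I l := fun h ↦ ((pottsClassMap_eq_iff hkl).1 h).2.2 hind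
        rw [if_neg hne, matroidRank_eq_ncard_of_indep hind,
          Set.ncard_insert_of_notMem (fun h ↦ (Set.mem_insert_iff.1 h).elim hkl hkI) (Set.toFinite _),
          Set.ncard_insert_of_notMem hlI (Set.toFinite _)]
        ring
      · -- parallel pair: rank `|I| + 1`
        have heq : pottsClassMap M I k = pottsClassMap M I l := (pottsClassMap_eq_iff hkl).2 ⟨hk, hl, hind⟩
        rw [if_pos heq, matroidRank_insert_of_not_indep hl.2 hind, Set.ncard_insert_of_notMem hlI (Set.toFinite _),
          pow_succ, inv_mul_cancel_right₀ hq]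
    · -- `k` a loop of `M/I`: rank `rk (I + l) = |I| + 1`
      have hne : pottsClassMap M I k ≠ pottsClassMap M I l := fun h ↦ hk ((pottsClassMap_eq_iff hkl).1 h).1
      rw [if_neg hne, pottsScale_some_of_not_mem q hk, pottsScale_some_of_mem q hl, Set.insert_comm,
        matroidRank_insert_insert_of_not_indep hI (fun h ↦ hk ⟨hkI, h⟩), matroidRank_insert_of_mem_nonloopsOver hl]
      ring
  · -- `l` a loop of `M/I`: rank `rk (I + k)`
    have hne : pottsClassMap M I k ≠ pottsClassMap M I l := fun h ↦ hl ((pottsClassMap_eq_iff hkl).1 h).2.1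
    rw [if_neg hne, pottsScale_some_of_not_mem q hl, matroidRank_insert_insert_of_not_indep hI (fun h ↦ hl ⟨hlI, h⟩),
      inv_pow_matroidRank_insert hI hkI q]
    ring

end Contraction

/-! ## §4 The Hessian matrices of `∂^α Z_{q,M}` -/

section Hessians

variable [Fintype σ] [DecidableEq σ]

omit [DecidableEq σ] in
/-- Membership in the support of `Z_{q,M}` by coordinates: squarefree `σ`-part and the right `w_0`-exponent.
[cite: BrandenHuh2019, §4.3 proof of Lemma 4.11] -/
theorem mem_indepExp_freeOn_iff_coord {γ : Option σ →₀ ℕ} :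
    γ ∈ indepExp (Matroid.freeOn (Set.univ : Set σ)) ↔
      (∀ k, γ (some k) ≤ 1) ∧ γ none = Fintype.card σ - (sigmaSupport γ).ncard := by
  rw [mem_indepExp_iff]
  exact ⟨fun h ↦ ⟨h.1, h.2.2⟩, fun h ↦ ⟨h.1, Matroid.freeOn_indep_iff.2 (Set.subset_univ _), h.2⟩⟩

/-- If some `σ`-coordinate of `γ` is `≥ 2` then `γ! coeff_γ Z_{q,M} = 0` (`Z_{q,M}` is multi-affine in `w_1, …, w_n`).
[cite: BrandenHuh2019, §4.3 proof of Thm. 4.10] -/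
theorem normCoeff_pottsPoly_eq_zero_of_two_le (q : ℝ) (M : Matroid σ) {γ : Option σ →₀ ℕ} {k : σ} (hk : 2 ≤ γ (some k)) :
    normCoeff γ (pottsPoly q M) = 0 := by
  rw [normCoeff_pottsPoly, if_neg]
  exact fun h ↦ by have := (mem_indepExp_freeOn_iff_coord.1 h).1 k; omega

/-- The nonzero normalised coefficients: for `γ` with squarefree `σ`-part `A` and `γ_0 = n - |A|`,
`γ! coeff_γ Z_{q,M} = (γ_0)! q^{-rk_M(A)}`. [cite: BrandenHuh2019, §4.3 proof of Thm. 4.10] -/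
theorem normCoeff_pottsPoly_of_coord (q : ℝ) (M : Matroid σ) {γ : Option σ →₀ ℕ} (h01 : ∀ k, γ (some k) ≤ 1)
    (h0 : γ none = Fintype.card σ - (sigmaSupport γ).ncard) :
    normCoeff γ (pottsPoly q M) = ((γ none)! : ℝ) * q⁻¹ ^ matroidRank M (sigmaSupport γ) := by
  rw [normCoeff_pottsPoly, if_pos (mem_indepExp_freeOn_iff_coord.2 ⟨h01, h0⟩)]

/-- The entry `(0, l)` of the Hessian of `∂^α Z_{q,M}`, `α = (m-2) e_0 + e_S`, `I` a basis of `S`: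
`(m-2)! q^{-rk S} · d_l · (m-1)[l ∉ S]`. [cite: BrandenHuh2019, §4.3 proof of Thm. 4.10
("`(n-1)! Z^1_{q,M}(w) w_0`", "`Z^1_{q,M}(w) = e^1_{[n]}(w)`" after the change of variables)] -/
theorem normCoeff_pottsPoly_add_none_some {q : ℝ} {M : Matroid σ} {α : Option σ →₀ ℕ} {I : Set σ} {m : ℕ}
    (h01 : ∀ k, α (some k) ≤ 1) (hI : M.IsBasis' I (sigmaSupport α))
    (hm : Fintype.card σ = m + (sigmaSupport α).ncard) (hα0 : α none + 2 = m)
    {T : Finset σ} (hT : ∀ k, k ∈ T ↔ k ∉ sigmaSupport α) (l : σ) :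
    normCoeff (α + Finsupp.single none 1 + Finsupp.single (some l) 1) (pottsPoly q M) =
      ((m - 2)! : ℝ) * q⁻¹ ^ matroidRank M (sigmaSupport α) *
        (pottsScale q M I (some l) * if l ∈ T then (m : ℝ) - 1 else 0) := by
  have hm2 : 2 ≤ m := by omega
  have hIS : I ⊆ sigmaSupport α := hI.subset
  by_cases hlS : l ∈ sigmaSupport α
  · -- `γ_l = 2`: zero on both sides
    rw [if_neg (fun h ↦ (hT l).1 h hlS), mul_zero, mul_zero]
    refine normCoeff_pottsPoly_eq_zero_of_two_le q M (k := l) ?_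
    rw [add_single_single_apply, if_neg (Option.some_ne_none l).symm, if_pos rfl]
    rw [mem_sigmaSupport] at hlS
    omega
  · have hαl : α (some l) = 0 := by rw [mem_sigmaSupport, not_not] at hlS; exact hlS
    have hsupp : sigmaSupport (α + Finsupp.single none 1 + Finsupp.single (some l) 1) = insert l (sigmaSupport α) := by
      rw [sigmaSupport_add_single_some, sigmaSupport_add_single_none]
    rw [normCoeff_pottsPoly_of_coord q M, if_pos ((hT l).2 hlS), hsupp]
    · -- the value: `(m-1)! q^{-rk(S + l)} = (m-2)! q^{-|I|} · d_l · (m-1)`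
      rw [add_single_single_apply, if_pos rfl, if_neg (Option.some_ne_none l), add_zero,
        ← Set.union_singleton, matroidRank_union_eq_of_isBasis' hI, Set.union_singleton,
        inv_pow_matroidRank_insert hI.indep (fun h ↦ hlS (hIS h)) q, matroidRank_eq_ncard_of_isBasis' hI]
      have : α none + 1 = (m - 2) + 1 := by omega
      rw [this, Nat.factorial_succ]
      have hc : ((m - 2 : ℕ) : ℝ) = (m : ℝ) - 2 := by rw [Nat.cast_sub hm2]; norm_num
      push_cast
      rw [hc]
      ring
    · intro k
      rw [add_single_single_apply, if_neg (Option.some_ne_none k).symm, add_zero]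
      by_cases hkl : l = k
      · subst hkl; rw [hαl, if_pos rfl]
      · rw [if_neg (fun h ↦ hkl (Option.some_injective _ h))]; simpa using h01 k
    · rw [hsupp, add_single_single_apply, if_pos rfl, if_neg (Option.some_ne_none l), add_zero,
        Set.ncard_insert_of_notMem hlS (Set.toFinite _)]
      omega

/-- **The Hessian matrix of `∂^α Z_{q,M}` for `α = (m-2) e_0 + e_S`** (`S ⊆ σ` squarefree support, `I` a basis of `S` in
`M`, `m = n - |S|`, `T = σ ∖ S`): entrywise `(α + e_i + e_j)! coeff Z_{q,M} = (m-2)! q^{-rk_M(S)} · d_i d_j · H_{ij}` with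
`H = pottsMatrix T (pottsClassMap M I) q m` and `d = pottsScale q M I` — i.e. `∂^α Z_{q,M} = q^{-rk S} ∂_0^{m-2} Z_{q,M/S}`,
whose Hessian is Brändén–Huh's quadratic form `(m!/2) w_0² + (m-1)! Z^1 w_0 + (m-2)! Z^2` before their change of variables.
[cite: BrandenHuh2019, §4.3 proof of Thm. 4.10 ("`∂_i Z_{q,M} = q^{-rk_M(i)} Z_{q,M/i}` […] it is enough to prove that the
following quadratic form is stable: `(n!/2) w_0^2 + (n-1)! Z^1_{q,M}(w) w_0 + (n-2)! Z^2_{q,M}(w)`")] -/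
theorem normCoeff_pottsPoly_add_eq {q : ℝ} (hq : q ≠ 0) {M : Matroid σ} {α : Option σ →₀ ℕ} {I : Set σ} {m : ℕ}
    (h01 : ∀ k, α (some k) ≤ 1) (hI : M.IsBasis' I (sigmaSupport α))
    (hm : Fintype.card σ = m + (sigmaSupport α).ncard) (hα0 : α none + 2 = m)
    {T : Finset σ} (hT : ∀ k, k ∈ T ↔ k ∉ sigmaSupport α) [DecidableEq (Option (Quotient (parallelOverSetoid M I)) ⊕ σ)]
    (i j : Option σ) :
    normCoeff (α + Finsupp.single i 1 + Finsupp.single j 1) (pottsPoly q M) =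
      ((m - 2)! : ℝ) * q⁻¹ ^ matroidRank M (sigmaSupport α) *
        (pottsScale q M I i * pottsScale q M I j * pottsMatrix T (pottsClassMap M I) q m i j) := by
  have hm2 : 2 ≤ m := by omega
  have hIS : I ⊆ sigmaSupport α := hI.subset
  cases i with
  | none => cases j with
    | none =>
      -- `γ = α + 2 e_0`, value `m! q^{-rk S}`
      rw [pottsMatrix_none_none, pottsScale_none, one_mul, one_mul, normCoeff_pottsPoly_of_coord q M,
        sigmaSupport_add_single_none, sigmaSupport_add_single_none, add_single_single_apply, if_pos rfl]
      · have : α none + 1 + 1 = m := by omega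
        rw [this]
        obtain ⟨r, rfl⟩ : ∃ r, m = r + 2 := ⟨m - 2, by omega⟩
        rw [Nat.add_sub_cancel, Nat.factorial_succ, Nat.factorial_succ]
        push_cast
        ring
      · intro k
        rw [add_single_single_apply, if_neg (Option.some_ne_none k).symm]; simpa using h01 k
      · rw [sigmaSupport_add_single_none, sigmaSupport_add_single_none, add_single_single_apply, if_pos rfl]; omega
    | some l =>
      rw [pottsMatrix_none_some, pottsScale_none, one_mul]
      exact normCoeff_pottsPoly_add_none_some h01 hI hm hα0 hT l
  | some k => cases j with
    | none =>
      -- symmetric to the previous case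
      rw [pottsMatrix_some_none, pottsScale_none, mul_one, add_right_comm]
      exact normCoeff_pottsPoly_add_none_some h01 hI hm hα0 hT k
    | some l =>
      rw [pottsMatrix_some_some]
      by_cases hgood : k ∈ T ∧ l ∈ T ∧ k ≠ l
      · obtain ⟨hkT, hlT, hkl⟩ := hgood
        have hkS : k ∉ sigmaSupport α := (hT k).1 hkT
        have hlS : l ∉ sigmaSupport α := (hT l).1 hlT
        have hαk : α (some k) = 0 := by rw [mem_sigmaSupport, not_not] at hkS; exact hkS
        have hαl : α (some l) = 0 := by rw [mem_sigmaSupport, not_not] at hlS; exact hlS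
        have hsupp : sigmaSupport (α + Finsupp.single (some k) 1 + Finsupp.single (some l) 1) =
            insert l (insert k (sigmaSupport α)) := by
          rw [sigmaSupport_add_single_some, sigmaSupport_add_single_some]
        have hlk : l ∉ insert k (sigmaSupport α) := fun h ↦ (Set.mem_insert_iff.1 h).elim (fun e ↦ hkl e.symm) hlS
        rw [if_pos ⟨hkT, hlT, hkl⟩, normCoeff_pottsPoly_of_coord q M, hsupp]
        · rw [add_single_single_apply, if_neg (Option.some_ne_none k), if_neg (Option.some_ne_none l), add_zero, add_zero,
            show insert l (insert k (sigmaSupport α)) = sigmaSupport α ∪ {l, k} by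
              rw [Set.union_insert, Set.union_singleton],
            matroidRank_union_eq_of_isBasis' hI, Set.union_insert, Set.union_singleton,
            inv_pow_matroidRank_insert_insert hI.indep (Ne.symm hkl) (fun h ↦ hlS (hIS h)) (fun h ↦ hkS (hIS h)) hq,
            matroidRank_eq_ncard_of_isBasis' hI]
          have : α none = m - 2 := by omega
          rw [this, mul_comm (pottsScale q M I (some l)) (pottsScale q M I (some k))]
          have hsym : (if pottsClassMap M I l = pottsClassMap M I k then q else 1) =
              (if pottsClassMap M I k = pottsClassMap M I l then q else 1) := if_congr eq_comm rfl rfl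
          rw [hsym]
          ring
        · intro k'
          rw [add_single_single_apply]
          by_cases h1 : k = k'
          · subst h1
            rw [hαk, if_pos rfl, if_neg (fun h ↦ hkl (Option.some_injective _ h).symm)]
          · rw [if_neg (fun h ↦ h1 (Option.some_injective _ h))]
            by_cases h2 : l = k'
            · subst h2; rw [hαl, if_pos rfl]
            · rw [if_neg (fun h ↦ h2 (Option.some_injective _ h))]; simpa using h01 k'
        · rw [hsupp, add_single_single_apply, if_neg (Option.some_ne_none k), if_neg (Option.some_ne_none l), add_zero,
            add_zero, Set.ncard_insert_of_notMem hlk (Set.toFinite _), Set.ncard_insert_of_notMem hkS (Set.toFinite _)]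
          omega
      · -- some `σ`-coordinate of `γ` is `2`: zero on both sides
        rw [if_neg hgood, mul_zero, mul_zero]
        by_cases hkl : k = l
        · subst hkl
          refine normCoeff_pottsPoly_eq_zero_of_two_le q M (k := k) ?_
          rw [add_single_single_apply, if_pos rfl]; omega
        · by_cases hkT : k ∈ T
          · have hlS : l ∈ sigmaSupport α := by
              by_contra hlS; exact hgood ⟨hkT, (hT l).2 hlS, hkl⟩
            refine normCoeff_pottsPoly_eq_zero_of_two_le q M (k := l) ?_
            rw [add_single_single_apply, if_neg (fun h ↦ hkl (Option.some_injective _ h)), if_pos rfl]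
            rw [mem_sigmaSupport] at hlS; omega
          · have hkS : k ∈ sigmaSupport α := by by_contra hkS; exact hkT ((hT k).2 hkS)
            refine normCoeff_pottsPoly_eq_zero_of_two_le q M (k := k) ?_
            rw [add_single_single_apply, if_pos rfl]
            rw [mem_sigmaSupport] at hkS; omega

end Hessians

/-! ## §5 `Z_{q,M}` is Lorentzian (Theorem 4.10) -/

section Main

variable [Fintype σ] [DecidableEq σ]

/-- A diagonal congruence does not increase the positive index: `sigPos (D H D) ≤ sigPos H` for `D = diag(d)` (pull back
along `x ↦ (d_i x_i)_i`). [cite: BrandenHuh2019, §4.3 proof of Thm. 4.10 ("We prove the inequality after making the change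
of variables `w_i ↦ q w_i`")] -/
theorem sigPos_toBilin'_diag_mul_le {ι : Type*} [Fintype ι] [DecidableEq ι] (H : Matrix ι ι ℝ) (d : ι → ℝ) :
    sigPos (Matrix.toBilin' (Matrix.of fun i j ↦ d i * d j * H i j)).toQuadraticMap ≤
      sigPos (Matrix.toBilin' H).toQuadraticMap := by
  set Dmap : (ι → ℝ) →ₗ[ℝ] (ι → ℝ) :=
    { toFun := fun x i ↦ d i * x i
      map_add' := fun x y ↦ by ext i; simp [mul_add]
      map_smul' := fun c x ↦ by ext i; simp; ring } with hD
  refine LinearMap.BilinForm.sigPos_le_sigPos_of_comp _ _ Dmap fun x y ↦ ?_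
  rw [Matrix.toBilin'_apply, Matrix.toBilin'_apply]
  simp only [hD, LinearMap.coe_mk, AddHom.coe_mk, Matrix.of_apply]
  exact Finset.sum_congr rfl fun i _ ↦ Finset.sum_congr rfl fun j _ ↦ by ring

/-- **Brändén–Huh, Theorem 4.10: for any matroid `M` and `0 < q ≤ 1`, the homogeneous multivariate Tutte polynomial
`Z_{q,M}` is Lorentzian.** Proof as printed, in the lane's Def-2.6 form (`mem_lorentzian_iff_forall_sigPos_normCoeff`):
the support is M-convex (Lemma 4.11); for `α ∈ Δ^{n-2}_{n+1}` with a non-squarefree `σ`-part `∂^α Z_{q,M} = 0`; otherwise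
`α = (m-2) e_0 + e_S` and the Hessian of `∂^α Z_{q,M} = q^{-rk S} ∂_0^{m-2} Z_{q,M/S}` is `(m-2)! q^{-rk S} · D H D` with
`H` the rescaled matrix of `PottsHessianSignature` (`D` = the change of variables `w_i ↦ q w_i` on the non-loops of `M/S`),
which has at most one positive eigenvalue by Lemma 4.12 (`sigPos_pottsMatrix_le_one`).
[cite: BrandenHuh2019, §4.3 Thm. 4.10 (with Lemmas 4.11, 4.12 and the printed proof)] -/
theorem pottsPoly_mem_lorentzian (M : Matroid σ) {q : ℝ} (hq : 0 < q) (hq1 : q ≤ 1) :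
    pottsPoly q M ∈ lorentzian (Option σ) (Fintype.card σ) := by
  classical
  rcases Nat.lt_or_ge (Fintype.card σ) 2 with hlt | hge
  · exact pottsPoly_mem_lorentzian_of_card_le_one hq.le M (by omega)
  obtain ⟨m', hm'⟩ : ∃ m', Fintype.card σ = m' + 2 := ⟨Fintype.card σ - 2, by omega⟩
  rw [hm', mem_lorentzian_iff_forall_sigPos_normCoeff, and_iff_right ⟨hm' ▸ isHomogeneous_pottsPoly q M,
    coeff_pottsPoly_nonneg hq.le M, isMConvex_support_pottsPoly hq M⟩]
  intro α hα
  -- Case A: some `σ`-coordinate of `α` is `≥ 2`: `∂^α Z = 0`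
  by_cases h01 : ∀ k, α (some k) ≤ 1
  swap
  · push Not at h01
    obtain ⟨k, hk⟩ := h01
    exact sigPos_toBilin'_le_one_of_eq_zero (Matrix.ext fun i j ↦ by
      rw [Matrix.of_apply, Matrix.zero_apply]
      refine normCoeff_pottsPoly_eq_zero_of_two_le q M (k := k) ?_
      rw [add_single_single_apply]; omega)
  -- Case B: `α = (m-2) e_0 + e_S`, `S` squarefree; `I` a basis of `S`, `m = n - #S ≥ 2`, `T = σ ∖ S`
  set S := sigmaSupport α with hSdef
  obtain ⟨I, hI⟩ := M.exists_isBasis' S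
  have hdeg : α none + S.ncard = m' := by
    rw [← hα, degree_eq_none_add_sum, sum_some_eq_ncard_sigmaSupport h01]
  have hSn : S.ncard ≤ Fintype.card σ := ncard_le_card S
  set m : ℕ := Fintype.card σ - S.ncard with hmdef
  have hm : Fintype.card σ = m + S.ncard := by omega
  have hα0 : α none + 2 = m := by omega
  set T : Finset σ := (Set.toFinite Sᶜ).toFinset with hTdef
  have hT : ∀ k, k ∈ T ↔ k ∉ S := fun k ↦ by rw [hTdef, Set.Finite.mem_toFinset, Set.mem_compl_iff]
  have hTcard : T.card = m := by
    rw [hTdef, ← Set.ncard_eq_toFinset_card _ (Set.toFinite Sᶜ), hmdef]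
    have := Set.ncard_add_ncard_compl S
    rw [Nat.card_eq_fintype_card] at this
    omega
  have hN : (Matrix.of fun i j ↦ normCoeff (α + Finsupp.single i 1 + Finsupp.single j 1) (pottsPoly q M)) =
      (((m - 2)! : ℝ) * q⁻¹ ^ matroidRank M S) • Matrix.of fun i j ↦
        pottsScale q M I i * pottsScale q M I j * pottsMatrix T (pottsClassMap M I) q m i j := by
    ext i j
    rw [Matrix.of_apply, Matrix.smul_apply, Matrix.of_apply, smul_eq_mul]
    exact normCoeff_pottsPoly_add_eq hq.ne' h01 hI hm hα0 hT i j
  have hc : 0 < ((m - 2)! : ℝ) * q⁻¹ ^ matroidRank M S :=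
    mul_pos (by exact_mod_cast Nat.factorial_pos (m - 2)) (pow_pos (inv_pos.2 hq) _)
  rw [hN, map_smul, LinearMap.BilinMap.toQuadraticMap_smul, sigPos_smul_eq_of_pos _ hc]
  refine (sigPos_toBilin'_diag_mul_le _ _).trans (sigPos_pottsMatrix_le_one T _ hq.le hq1 ?_ ?_)
  · exact_mod_cast hTcard.le
  · exact_mod_cast (show 1 < m by omega)

end Main

end Literature.Combinatorics.LorentzianPolynomials

end
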